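import Literature.Barriers.CriticalPhenomena.GridSAWSquaresPieceFn
import Literature.Barriers.CriticalPhenomena.GridSAWSquaresShiftFP
import Literature.Barriers.CriticalPhenomena.GridSAWTowersMachine
import HarnessLib

/-!
# Squares step of Theorem 7 (4) (Liśkiewicz–Ogihara–Toda 2003), machine part: the instance map
# `R₁ = squaresReduce` IS polynomial time — assembly of the machine and discharge of
# `LOT2003_thm7_anyLength_squares`

Final file of the squares step. `GridSAWSquaresShift.lean` reduced the named sub-fact
`LOT2003_thm7_anyLength_squares : GRIDHAMPATHCOUNT ≤ᵖ_{r-shift} SAWCOUNT₄` (Theorem 7 (4), "Then the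
pair `(R₁, R₃)` witnesses that the fourth type is complete for `#P` under
`≤ᵖ_{r-shift}`-reductions") to the machine fact `LOT2003_thm7_anyLength_squares_FP :
squaresReduce ∈ FP ∧ encodeNat ∘ squaresReduceShift ∈ FP`; `GridSAWSquaresShiftFP.lean` proved the
shift half (`squaresReduceShift_mem_FP`, `LOT2003_thm7_anyLength_squares_of_reduce_FP`). This file
assembles a brick function `SquaresGen.squaresCodeFn ∈ FP` and proves `squaresCodeFn =
squaresReduce`, from the parts now in the tree:

* (A) `GridSAWInstanceCanon.lean` — `canonDrawnGraphFn w = encode (decDrawnGraph w)`, the total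
  decoder (so every later stage sees a canonical code);
* (B) `GridSAWSquaresShiftFP.lean` — the one-bit tests `shiftValidF` (`IsGridDrawing P D ∧ s < N ∧
  t < N`, by the drawing checker of `GridSAWDrawingChecker.lean`) and `shiftGeTwoF` (`2 ≤ N`) on
  canonical codes;
* (C) `GridSAWSquaresEnumeration.lean` + `GridSAWSquaresPieceFn.lean` — the generator
  `genSqItemsFn (ctx code Λ (-σ)) = encList (E.map encode)`, `E = (squaresInstance P D s t).1`;
* (D) `GridSAWTowersMachine.lean` — the fields of the canonical code (`TowerGen.gPF`, …,
  `hdrPF = 1^N`, `hdrD'F = 1^{|D|}`, `itemsD'F`), `1^Λ` by the max-fold `lamFn` (`lamFn_code`), the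
  point look-ups `psF`, `qtF` (`encPt P[s]`, `encPt P[t]`), the candidate `candF = 1^{|π_a| - 1}`
  of a fold argument;
* (E) this file — on the canonical code `code P D s t`: `uBetacF = 1^β`, `uFaccF = 1^k`; the
  sum-fold `sumFn = 1^{Σ_e (|π_e| - 1)}` (`sumStep`, `sumFn_code`, `foldl_add_eq_sum`); the scaled
  end images `σ = k P[s]`, `τ = k P[t]` as difference pairs (`ks1F`, …); the context
  `ctxsF = ⟨code, ⟨1^Λ, -σ⟩⟩` (`ctxsF_code`); the unary header `hdrEsF = 1^{|E|}`,
  `|E| = k Σ_e (|π_e| - 1) + 3β|D|` (`length_squaresInstance_fst`); `tausF` (the code of `τ - σ`,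
  `squaresInstance_snd`); **`mainSqF`** with `mainSqF_code : mainSqF (code P D s t) = encode
  (squaresInstance P D s t)` (`encode_anyLength_eq`); the branches `outSqF` (valid and `N ≥ 2`:
  `mainSqF`; valid and `N ≤ 1`: the code of the unit square; invalid: the code of the empty
  instance), **`outSqF_code : outSqF (code P D s t) = squaresReduce (code P D s t)`**;
  `squaresCodeFn = outSqF ∘ canonDrawnGraphFn`, **`squaresCodeFn_mem_FP`**,
  **`squaresCodeFn_eq_squaresReduce`** (`squaresReduce_canon`: `squaresReduce` reads its input
  through the total decoder), **`squaresReduce_mem_FP`**,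
  **`LOT2003_thm7_anyLength_squares_FP_holds`** and **`LOT2003_thm7_anyLength_squares_holds`**.

No machine is written anywhere: every stage is an `FP` brick assembly whose value is computed
symbolically on the codes that matter and whose membership in `FP` is compositional. With this
file Theorem 7 (4) (`LOT2003_thm7_anyLength`) rests on the single named fact
`LOT2003_lemma4_gadgets` (`GridSAWCountingAnyLengthAssembly.LOT2003_thm7_anyLength_of_remaining_facts`
with `LOT2003_prop2_sharp3SAT_holds` and `LOT2003_thm7_anyLength_squares_FP_holds`).

## References

* M. Liśkiewicz, M. Ogihara, S. Toda, *The complexity of counting self-avoiding walks in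
  subgraphs of two-dimensional grids and hypercubes*, TCS 304 (2003) 129–156, §4, proof of
  Theorem 7 (fourth type: `E₃`, "Then the pair `(R₁, R₃)` witnesses that the fourth type is
  complete for `#P` under `≤ᵖ_{r-shift}`-reductions"), §2.2 (`≤ᵖ_{r-shift}`: `R₁` polynomial-time).
* S. Arora, B. Barak, *Computational Complexity: A Modern Approach*, CUP 2009, §1.3 (polynomial
  time: composition, bounded loops), §0.1 (codes).
-/

noncomputable section

namespace Literature.Barriers.CriticalPhenomena.GridSAW

open _root_.Computability Literature.Computability.Complexity Literature.Computability.Complexity.Brick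
  Polynomial

namespace SquaresGen

open TowerGen

/-! ### `1^β`, `1^k` on the canonical code -/

/-- `1^β`, `β = N² + 1`, from the header `1^N` of the point-list code. [cite: LiskiewiczOgiharaToda2003, §4 (proof of Theorem 7, fourth type: β)] -/
def uBetacF : List Bool → List Bool := appF ∘ fanoutFn (HashBricks.umulFn ∘ fanoutFn hdrPF hdrPF) fun _ => [true]
/-- `1^k`, `k = 2β + 3`. [cite: LiskiewiczOgiharaToda2003, §4 (proof of Theorem 7: the enlargement factor)] -/
def uFaccF : List Bool → List Bool := appF ∘ fanoutFn (onesMulFn 2 ∘ uBetacF) fun _ => [true, true, true]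

/-- `uBetacF ∈ FP`. [folklore] -/
theorem uBetacF_mem_FP : uBetacF ∈ FP :=
  comp_mem_FP appF_mem_FP (fanoutFn_mem_FP (comp_mem_FP HashBricks.umulFn_mem_FP (fanoutFn_mem_FP hdrPF_mem_FP hdrPF_mem_FP))
    (const_mem_FP _))
/-- `uFaccF ∈ FP`. [folklore] -/
theorem uFaccF_mem_FP : uFaccF ∈ FP :=
  comp_mem_FP appF_mem_FP (fanoutFn_mem_FP (comp_mem_FP (onesMulFn_mem_FP 2) uBetacF_mem_FP) (const_mem_FP _))

section CodeConstants
variable (P : List GridPoint) (D : List DrawnEdge) (s t : ℕ)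
/-- Value of `uBetacF` on the canonical code of a presentation. [folklore] -/
theorem uBetacF_code : uBetacF (code P D s t) = ones (squaresBeta P.length) := by
  rw [uBetacF, Function.comp_apply, fanoutFn_apply, Function.comp_apply, fanoutFn_apply, hdrPF_code,
    HashBricks.umulFn_boolPair, appF_boolPair, show [true] = ones 1 from rfl, Com.ones_append, squaresBeta]
/-- Value of `uFaccF` on the canonical code of a presentation. [folklore] -/
theorem uFaccF_code : uFaccF (code P D s t) = ones (squaresK P.length) := by
  rw [uFaccF, Function.comp_apply, fanoutFn_apply, Function.comp_apply, uBetacF_code, onesMulFn_ones, appF_boolPair,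
    show [true, true, true] = ones 3 from rfl, Com.ones_append, squaresK]
end CodeConstants

/-! ### `Σ_e (|π_e| - 1)` in unary, by a sum-fold over the edge codes -/

/-- The step of the sum-fold: append the candidate `1^{|π_a| - 1}` to the accumulator. [folklore] -/
def sumStep : List Bool → List Bool := appF ∘ fanoutFn (sndF ∘ sndF) candF
/-- **`1^{Σ_e (|π_e| - 1)}`**: the sum-fold over the items of `D`, started at `1⁰`. [folklore] -/
def sumFn : List Bool → List Bool := foldFn sumStep (fun _ => []) ∘ fanoutFn (fun _ => []) itemsD'F

/-- `sumStep ∈ FP`. [folklore] -/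
theorem sumStep_mem_FP : sumStep ∈ FP :=
  comp_mem_FP appF_mem_FP (fanoutFn_mem_FP (comp_mem_FP sndF_mem_FP sndF_mem_FP) candF_mem_FP)
/-- Size bound for `sumStep`. [folklore] -/
theorem foldGrowth_sumStep : FoldGrowth 0 sumStep := fun v => by
  have := length_candF_le v
  simp only [sumStep, Function.comp_apply, fanoutFn_apply, appF_boolPair, List.length_append]
  omega
/-- `sumFn ∈ FP`. [folklore] -/
theorem sumFn_mem_FP : sumFn ∈ FP :=
  comp_mem_FP (foldFn_mem_FP sumStep_mem_FP (const_mem_FP _) foldGrowth_sumStep)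
    (fanoutFn_mem_FP (const_mem_FP _) itemsD'F_mem_FP)

/-- Value of `sumStep`. [folklore] -/
theorem sumStep_apply (u : List Bool) (d : DrawnEdge) (n : ℕ) :
    sumStep (boolPair u (boolPair (encDE d) (ones n))) = ones (n + (d.2.2.length - 1)) := by
  simp only [sumStep, Function.comp_apply, fanoutFn_apply, sndF_boolPair, candF_apply, appF_boolPair, Com.ones_append]

/-- A left fold of additions is a sum. [folklore] -/
theorem foldl_add_eq_sum {α : Type} (f : α → ℕ) : ∀ (L : List α) (n : ℕ), L.foldl (fun m a => m + f a) n = n + (L.map f).sum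
  | [], n => by simp
  | a :: L, n => by rw [List.foldl_cons, foldl_add_eq_sum f L, List.map_cons, List.sum_cons, Nat.add_assoc]

/-- **`sumFn (code) = 1^{Σ_e (|π_e| - 1)}`.** [folklore] -/
theorem sumFn_code (P : List GridPoint) (D : List DrawnEdge) (s t : ℕ) :
    sumFn (code P D s t) = ones (D.map fun d => d.2.2.length - 1).sum := by
  rw [sumFn, Function.comp_apply, fanoutFn_apply, itemsD'F_code, foldFn_apply]
  simp only [sndF_boolPair, decNil_encList]
  have key : ∀ (u : List Bool) (L : List DrawnEdge) (n : ℕ),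
      (L.map encDE).foldl (fun acc a => sumStep (boolPair u (boolPair a acc))) (ones n) =
        ones (n + (L.map fun d => d.2.2.length - 1).sum) := by
    intro u L
    induction L with
    | nil => intro n; simp
    | cons d L ih =>
      intro n
      rw [List.map_cons, List.foldl_cons, sumStep_apply, ih, List.map_cons, List.sum_cons, Nat.add_assoc]
  have h := key (boolPair [] (encList (D.map encDE))) D 0
  rw [Nat.zero_add] at h
  exact h

/-! ### `σ = k P[s]`, `τ = k P[t]`, the context, the header, the main output -/

/-- `dpEnc (k · P[s].1)`. [folklore] -/
def ks1F : List Bool → List Bool := zmulF ∘ fanoutFn (natZF ∘ uFaccF) (ofSMFn ∘ fstF ∘ psF)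
/-- `dpEnc (k · P[s].2)`. [folklore] -/
def ks2F : List Bool → List Bool := zmulF ∘ fanoutFn (natZF ∘ uFaccF) (ofSMFn ∘ sndF ∘ psF)
/-- `dpEnc (k · P[t].1)`. [folklore] -/
def kt1F : List Bool → List Bool := zmulF ∘ fanoutFn (natZF ∘ uFaccF) (ofSMFn ∘ fstF ∘ qtF)
/-- `dpEnc (k · P[t].2)`. [folklore] -/
def kt2F : List Bool → List Bool := zmulF ∘ fanoutFn (natZF ∘ uFaccF) (ofSMFn ∘ sndF ∘ qtF)
/-- **The context of the generator** built from the canonical code: `⟨code, ⟨1^Λ, -σ⟩⟩`.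
[folklore] -/
def ctxsF : List Bool → List Bool := fanoutFn (fun c => c) (fanoutFn lamFn (fanoutFn (znegF ∘ ks1F) (znegF ∘ ks2F)))
/-- `1^{|E₃|} = 1^{k Σ_e (|π_e| - 1) + 3β|D|}`: the unary header of the edge-list code. [folklore] -/
def hdrEsF : List Bool → List Bool :=
  appF ∘ fanoutFn (HashBricks.umulFn ∘ fanoutFn uFaccF sumFn)
    (HashBricks.umulFn ∘ fanoutFn (onesMulFn 3 ∘ uBetacF) hdrD'F)
/-- The code of the edge list `E₃ - σ`. [folklore] -/
def EsF : List Bool → List Bool := fanoutFn hdrEsF (genSqItemsFn ∘ ctxsF)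
/-- The code of `τ - σ`. [folklore] -/
def tausF : List Bool → List Bool :=
  fanoutFn (signMagOfZF ∘ zsubF ∘ fanoutFn kt1F ks1F) (signMagOfZF ∘ zsubF ∘ fanoutFn kt2F ks2F)
/-- **The main output**: the code of the instance `(E₃ - σ, τ - σ)`.
[cite: LiskiewiczOgiharaToda2003, §4 (proof of Theorem 7, fourth type: "the number of SAWs between the origin and the image of t′ in E₃")] -/
def mainSqF : List Bool → List Bool := fanoutFn EsF tausF

/-- `ks1F ∈ FP`. [folklore] -/
theorem ks1F_mem_FP : ks1F ∈ FP := comp_mem_FP zmulF_mem_FP (fanoutFn_mem_FP (comp_mem_FP natZF_mem_FP uFaccF_mem_FP)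
  (comp_mem_FP ofSMFn_mem_FP (comp_mem_FP fstF_mem_FP psF_mem_FP)))
/-- `ks2F ∈ FP`. [folklore] -/
theorem ks2F_mem_FP : ks2F ∈ FP := comp_mem_FP zmulF_mem_FP (fanoutFn_mem_FP (comp_mem_FP natZF_mem_FP uFaccF_mem_FP)
  (comp_mem_FP ofSMFn_mem_FP (comp_mem_FP sndF_mem_FP psF_mem_FP)))
/-- `kt1F ∈ FP`. [folklore] -/
theorem kt1F_mem_FP : kt1F ∈ FP := comp_mem_FP zmulF_mem_FP (fanoutFn_mem_FP (comp_mem_FP natZF_mem_FP uFaccF_mem_FP)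
  (comp_mem_FP ofSMFn_mem_FP (comp_mem_FP fstF_mem_FP qtF_mem_FP)))
/-- `kt2F ∈ FP`. [folklore] -/
theorem kt2F_mem_FP : kt2F ∈ FP := comp_mem_FP zmulF_mem_FP (fanoutFn_mem_FP (comp_mem_FP natZF_mem_FP uFaccF_mem_FP)
  (comp_mem_FP ofSMFn_mem_FP (comp_mem_FP sndF_mem_FP qtF_mem_FP)))
/-- `ctxsF ∈ FP`. [folklore] -/
theorem ctxsF_mem_FP : ctxsF ∈ FP := fanoutFn_mem_FP (PolyTimeComputable.id _) (fanoutFn_mem_FP lamFn_mem_FP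
  (fanoutFn_mem_FP (comp_mem_FP znegF_mem_FP ks1F_mem_FP) (comp_mem_FP znegF_mem_FP ks2F_mem_FP)))
/-- `hdrEsF ∈ FP`. [folklore] -/
theorem hdrEsF_mem_FP : hdrEsF ∈ FP :=
  comp_mem_FP appF_mem_FP (fanoutFn_mem_FP
    (comp_mem_FP HashBricks.umulFn_mem_FP (fanoutFn_mem_FP uFaccF_mem_FP sumFn_mem_FP))
    (comp_mem_FP HashBricks.umulFn_mem_FP (fanoutFn_mem_FP (comp_mem_FP (onesMulFn_mem_FP 3) uBetacF_mem_FP) hdrD'F_mem_FP)))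
/-- `EsF ∈ FP`. [folklore] -/
theorem EsF_mem_FP : EsF ∈ FP := fanoutFn_mem_FP hdrEsF_mem_FP (comp_mem_FP genSqItemsFn_mem_FP ctxsF_mem_FP)
/-- `tausF ∈ FP`. [folklore] -/
theorem tausF_mem_FP : tausF ∈ FP := fanoutFn_mem_FP
  (comp_mem_FP signMagOfZF_mem_FP (comp_mem_FP zsubF_mem_FP (fanoutFn_mem_FP kt1F_mem_FP ks1F_mem_FP)))
  (comp_mem_FP signMagOfZF_mem_FP (comp_mem_FP zsubF_mem_FP (fanoutFn_mem_FP kt2F_mem_FP ks2F_mem_FP)))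
/-- **`mainSqF ∈ FP`.** [cite: AroraBarak2009, §1.3] -/
theorem mainSqF_mem_FP : mainSqF ∈ FP := fanoutFn_mem_FP EsF_mem_FP tausF_mem_FP

/-! ### Values on the canonical code of a valid presentation -/

/-- The code of an any-length instance, flat. [folklore] -/
theorem encode_anyLength_eq (E : EdgeList) (τ : GridPoint) :
    encodingAnyLengthInstance.encode (E, τ) =
      boolPair (boolPair (ones E.length) (encList (E.map (encodingGridPoint.pairBool encodingGridPoint).encode))) (encPt τ) := by
  show boolPair (encodingEdgeList.encode E) _ = _
  rw [encodingEdgeList, listBool_encode_eq_encList, OracleCompose.unaryEncodeNat_eq_replicate]; rfl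

section MainApply

variable {P : List GridPoint} {D : List DrawnEdge} (hD : IsGridDrawing P D) {s t : ℕ} (hs : s < P.length) (ht : t < P.length)

include hs in
/-- Value of `ks1F` on the canonical code of a presentation. [folklore] -/
theorem ks1F_code : ks1F (code P D s t) = dpEnc ((squaresK P.length : ℤ) * (P[s]).1) := by
  simp only [ks1F, Function.comp_apply, fanoutFn_apply, uFaccF_code, natZF_ones, psF_code P D hs t, encPt_eq,
    fstF_boolPair, ofSMFn_encInt, zmulF_boolPair, ival_dpEnc]
include hs in
/-- Value of `ks2F` on the canonical code of a presentation. [folklore] -/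
theorem ks2F_code : ks2F (code P D s t) = dpEnc ((squaresK P.length : ℤ) * (P[s]).2) := by
  simp only [ks2F, Function.comp_apply, fanoutFn_apply, uFaccF_code, natZF_ones, psF_code P D hs t, encPt_eq,
    sndF_boolPair, ofSMFn_encInt, zmulF_boolPair, ival_dpEnc]
include ht in
/-- Value of `kt1F` on the canonical code of a presentation. [folklore] -/
theorem kt1F_code : kt1F (code P D s t) = dpEnc ((squaresK P.length : ℤ) * (P[t]).1) := by
  simp only [kt1F, Function.comp_apply, fanoutFn_apply, uFaccF_code, natZF_ones, qtF_code P D s ht, encPt_eq,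
    fstF_boolPair, ofSMFn_encInt, zmulF_boolPair, ival_dpEnc]
include ht in
/-- Value of `kt2F` on the canonical code of a presentation. [folklore] -/
theorem kt2F_code : kt2F (code P D s t) = dpEnc ((squaresK P.length : ℤ) * (P[t]).2) := by
  simp only [kt2F, Function.comp_apply, fanoutFn_apply, uFaccF_code, natZF_ones, qtF_code P D s ht, encPt_eq,
    sndF_boolPair, ofSMFn_encInt, zmulF_boolPair, ival_dpEnc]

/-- The translation `-σ = -(k • P[s])` is the one of `squaresInstance`. [folklore] -/
theorem neg_smul_img_eq (P : List GridPoint) {s : ℕ} (hs : s < P.length) :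
    -((squaresK P.length : ℤ) • img P s) =
      (-((squaresK P.length : ℤ) * (P[s]).1), -((squaresK P.length : ℤ) * (P[s]).2)) := by
  rw [img_eq_getElem hs]; ext <;> simp

include hs in
/-- Value of `ctxsF` on the canonical code of a presentation: the context of the generator with
`Λ = maxEdges D` and the translation `-σ`. [folklore] -/
theorem ctxsF_code : ctxsF (code P D s t) = ctx (code P D s t) (maxEdges D) (-((squaresK P.length : ℤ) • img P s)) := by
  rw [neg_smul_img_eq P hs]
  simp only [ctxsF, fanoutFn_apply, Function.comp_apply, lamFn_code, ks1F_code hs, ks2F_code hs, znegF_eq, ival_dpEnc, ctx]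

/-- Value of `hdrEsF` on the canonical code of a presentation. [folklore] -/
theorem hdrEsF_code (P : List GridPoint) (D : List DrawnEdge) (s t : ℕ) :
    hdrEsF (code P D s t) =
      ones (squaresK P.length * (D.map fun d => d.2.2.length - 1).sum + 3 * squaresBeta P.length * D.length) := by
  simp only [hdrEsF, Function.comp_apply, fanoutFn_apply, uFaccF_code, sumFn_code, uBetacF_code, hdrD'F_code,
    onesMulFn_ones, HashBricks.umulFn_boolPair, appF_boolPair, Com.ones_append]

include hs ht in
/-- Value of `tausF` on the canonical code of a presentation. [folklore] -/
theorem tausF_code : tausF (code P D s t) =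
    encPt ((squaresK P.length : ℤ) * (P[t]).1 - (squaresK P.length : ℤ) * (P[s]).1,
      (squaresK P.length : ℤ) * (P[t]).2 - (squaresK P.length : ℤ) * (P[s]).2) := by
  simp only [tausF, fanoutFn_apply, Function.comp_apply, kt1F_code ht, ks1F_code hs, kt2F_code ht, ks2F_code hs,
    zsubF_boolPair, ival_dpEnc, signMagOfZF_dpEnc', encPt_eq]

include hs ht in
/-- The second component of `squaresInstance`: `τ - σ = k • P[t] - k • P[s]`. [folklore] -/
theorem squaresInstance_snd : (squaresInstance P D s t).2 =
    ((squaresK P.length : ℤ) * (P[t]).1 - (squaresK P.length : ℤ) * (P[s]).1,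
      (squaresK P.length : ℤ) * (P[t]).2 - (squaresK P.length : ℤ) * (P[s]).2) := by
  simp only [squaresInstance, img_eq_getElem hs, img_eq_getElem ht]
  ext <;> simp

include hD hs ht in
/-- **The main output is the code of `squaresInstance P D s t`.**
[cite: LiskiewiczOgiharaToda2003, §4 (proof of Theorem 7, fourth type: R₁(x) = (E₃, τ))] -/
theorem mainSqF_code : mainSqF (code P D s t) = encodingAnyLengthInstance.encode (squaresInstance P D s t) := by
  rw [show squaresInstance P D s t = ((squaresInstance P D s t).1, (squaresInstance P D s t).2) from rfl,
    encode_anyLength_eq, mainSqF, fanoutFn_apply, EsF, fanoutFn_apply, Function.comp_apply, hdrEsF_code,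
    ctxsF_code hs, genSqItemsFn_ctx_eq_encList hD s t, tausF_code hs ht, squaresInstance_snd hs ht,
    length_squaresInstance_fst hD s t]

end MainApply

/-! ### The branches and the instance map -/

/-- The code of the unit-square instance (image of the valid one-vertex presentations). [folklore] -/
def codeSq₁ : List Bool := encodingAnyLengthInstance.encode (unitSquare, ((1 : ℤ), (1 : ℤ)))
/-- The code of the empty instance (image of the invalid presentations). [folklore] -/
def codeSq₀ : List Bool := encodingAnyLengthInstance.encode (([] : EdgeList), gridOrigin)
/-- The instance map on canonical codes: valid and `N ≥ 2` ↦ `mainSqF`; valid and `N ≤ 1` ↦ the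
unit square; invalid ↦ the empty instance (the validity and size tests are `shiftValidF`,
`shiftGeTwoF` of `GridSAWSquaresShiftFP.lean`). [cite: LiskiewiczOgiharaToda2003, §4 (proof of Theorem 7, fourth type: R₁)] -/
def outSqF : List Bool → List Bool := iteFn shiftValidF (iteFn shiftGeTwoF mainSqF fun _ => codeSq₁) fun _ => codeSq₀
/-- **The instance map `R₁` of the squares step as a brick assembly**: canonicalise
(`GridSAWInstanceCanon.lean`), then branch. [cite: LiskiewiczOgiharaToda2003, §4 (proof of Theorem 7, fourth type: R₁)] -/
def squaresCodeFn : List Bool → List Bool := outSqF ∘ canonDrawnGraphFn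

/-- `outSqF ∈ FP`. [folklore] -/
theorem outSqF_mem_FP : outSqF ∈ FP :=
  iteFn_mem_FP shiftValidF_mem_FP (iteFn_mem_FP shiftGeTwoF_mem_FP mainSqF_mem_FP (const_mem_FP _)) (const_mem_FP _)
/-- **`squaresCodeFn ∈ FP`.** [cite: AroraBarak2009, §1.3 (closure of polynomial time under composition)] -/
theorem squaresCodeFn_mem_FP : squaresCodeFn ∈ FP := comp_mem_FP outSqF_mem_FP canonDrawnGraphFn_mem_FP

/-- **The brick assembly computes `squaresReduce` on canonical codes.**
[cite: LiskiewiczOgiharaToda2003, §4 (proof of Theorem 7, fourth type)] -/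
theorem outSqF_code (P : List GridPoint) (D : List DrawnEdge) (s t : ℕ) :
    outSqF (code P D s t) = squaresReduce (code P D s t) := by
  classical
  unfold squaresReduce
  rw [code, encodingDrawnGraphInstance.decode_encode, ← code, outSqF, iteFn_apply (shiftValidF_encode P D s t)]
  by_cases hv : IsGridDrawing P D ∧ s < P.length ∧ t < P.length
  · simp only [hv, and_self, decide_true, ↓reduceIte]
    rw [iteFn_apply (shiftGeTwoF_encode P D s t)]
    by_cases h2 : 2 ≤ P.length
    · simp only [h2, decide_true, ↓reduceIte]
      exact mainSqF_code hv.1 hv.2.1 hv.2.2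
    · simp only [h2, decide_false, Bool.false_eq_true, ↓reduceIte]
      rfl
  · simp only [hv, decide_false, Bool.false_eq_true, ↓reduceIte]
    rfl

/-- `squaresReduce` reads its input through the total decoder: its value on `w` is its value on
the canonical code of `decDrawnGraph w`. [folklore] -/
theorem squaresReduce_canon (w : List Bool) :
    squaresReduce w = squaresReduce (encodingDrawnGraphInstance.encode (decDrawnGraph w)) := by
  unfold squaresReduce
  rw [(decode_drawnGraph w).1, encodingDrawnGraphInstance.decode_encode]

/-- **The brick assembly IS `squaresReduce`.** [cite: LiskiewiczOgiharaToda2003, §4 (proof of Theorem 7, fourth type: R₁)] -/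
theorem squaresCodeFn_eq_squaresReduce : squaresCodeFn = squaresReduce := by
  funext w
  rcases hi : decDrawnGraph w with ⟨P, D, s, t⟩
  rw [squaresCodeFn, Function.comp_apply, (decode_drawnGraph w).2, squaresReduce_canon w, hi]
  exact outSqF_code P D s t

/-- **Discharge of the instance-map half of the machine fact of the squares step**:
`squaresReduce ∈ FP`. [cite: LiskiewiczOgiharaToda2003, §2.2 and §4 (proof of Theorem 7, fourth type: R₁ is polynomial time)] -/
theorem squaresReduce_mem_FP : squaresReduce ∈ FP := by
  rw [← squaresCodeFn_eq_squaresReduce]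
  exact squaresCodeFn_mem_FP

end SquaresGen

/-- **The machine fact of the squares step, DISCHARGED**: `squaresReduce ∈ FP` (this file) and
`encodeNat ∘ squaresReduceShift ∈ FP` (`GridSAWSquaresShiftFP.lean`).
[cite: LiskiewiczOgiharaToda2003, Theorem 7 (proof, fourth type: "Then the pair (R₁, R₃) witnesses …") and §2.2] -/
theorem LOT2003_thm7_anyLength_squares_FP_holds : LOT2003_thm7_anyLength_squares_FP :=
  ⟨SquaresGen.squaresReduce_mem_FP, squaresReduceShift_mem_FP⟩

/-- **The squares step of Theorem 7 (4) of Liśkiewicz–Ogihara–Toda 2003, DISCHARGED**: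
`GRIDHAMPATHCOUNT ≤ᵖ_{r-shift} SAWCOUNT₄` — the instance map `R₁ = squaresReduce` and the shift
`R₃ = squaresReduceShift` are polynomial time and `GRIDHAMPATHCOUNT w = SAWCOUNT₄ (R₁ w) div 2^{R₃ w}`
on every string (`GRIDHAMPATHCOUNT_eq_SAWCOUNT₄_div`).
[cite: LiskiewiczOgiharaToda2003, Theorem 7 (proof, fourth type)] -/
theorem LOT2003_thm7_anyLength_squares_holds : LOT2003_thm7_anyLength_squares :=
  LOT2003_thm7_anyLength_squares_of_FP LOT2003_thm7_anyLength_squares_FP_holds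


/-! ### Sanity checks -/

/-- Non-vacuity of the discharged reduction: the polynomial-time instance map sends the one-edge
presentation (`N = 2`, one Hamiltonian `0`–`1` path) to an instance whose walk count, shifted
right by `R₃ = β (N - 1) = 5` bits, is `1`. [folklore] -/
theorem SAWCOUNT₄_squaresCodeFn_oneEdge :
    SAWCOUNT₄ (SquaresGen.squaresCodeFn (encodingDrawnGraphInstance.encode (oneEdgeDrawing.1, oneEdgeDrawing.2, 0, 1))) /
        2 ^ squaresReduceShift (encodingDrawnGraphInstance.encode (oneEdgeDrawing.1, oneEdgeDrawing.2, 0, 1)) = 1 := by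
  rw [SquaresGen.squaresCodeFn_eq_squaresReduce, ← GRIDHAMPATHCOUNT_eq_SAWCOUNT₄_div,
    GRIDHAMPATHCOUNT_encode _ _ _ _ isGridDrawing_oneEdge (by decide) (by decide)]
  exact hamPathCount_oneEdge

/-- … with shift exactly `5`. [folklore] -/
theorem squaresReduceShift_oneEdge :
    squaresReduceShift (encodingDrawnGraphInstance.encode (oneEdgeDrawing.1, oneEdgeDrawing.2, 0, 1)) = 5 := by
  unfold squaresReduceShift
  rw [encodingDrawnGraphInstance.decode_encode]
  simp only
  rw [if_pos ⟨⟨isGridDrawing_oneEdge, by decide, by decide⟩, by decide⟩]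
  rfl

/-- … and a non-drawing (a diagonal) to a walk-free instance. [folklore] -/
theorem SAWCOUNT₄_squaresCodeFn_diagonal :
    SAWCOUNT₄ (SquaresGen.squaresCodeFn (encodingDrawnGraphInstance.encode
      ([((0 : ℤ), (0 : ℤ)), (1, 1)], [(0, 1, [((0 : ℤ), (0 : ℤ)), (1, 1)])], 0, 1))) = 0 := by
  rw [SquaresGen.squaresCodeFn_eq_squaresReduce]
  unfold squaresReduce
  rw [encodingDrawnGraphInstance.decode_encode]
  simp only
  rw [if_neg (fun h' => not_isGridDrawing_diagonal h'.1), SAWCOUNT₄_encode _ _ (fun e he => by simp at he),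
    sawCountAnyLength_nil]

end Literature.Barriers.CriticalPhenomena.GridSAW
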